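import Summits.BirchSwinnertonDyer.BirchSwinnertonDyer.Theorems.SoloInformedJointUniform
import Literature.NumberTheory.EllipticCurves.PAdicBSD
import Literature.NumberTheory.EllipticCurves.BSDInvariants
import Literature.NumberTheory.EllipticCurves.MordellWeilTheoremProofs
import Literature.NumberTheory.EllipticCurves.MordellWeilProofs
import Literature.NumberTheory.EllipticCurves.RegulatorBasisProofs
import Literature.NumberTheory.EllipticCurves.PAdicHeightsRegulatorProofs
import HarnessLib

/-!
# SoloInformedJointUniformOfBSD — the uniform joint receptacle is an intermediate of BSD ∧ p-adic BSD

`SoloInformedJointUniform` typed the `p`-uniform joint higher Gross–Zagier identity `(ZZ_r^u)`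
(`JointHigherGrossZagierUnif r`) and derived the summit `BirchSwinnertonDyer` from `(ZZ_r^u)_{r ≥ 2}`
plus somewhere-non-degeneracy of the canonical `p`-adic height. This file certifies the
normalisation of that receptacle against the two conjectures it abstracts, as they are formalised
in the tree:

* `soloInformedUnif_instance_of_bsdTriple_of_padicBSD`: for ONE globally minimal `E/ℚ`, the BSD
  triple (`W.BSDTriple`: RANK, `Ш` finite, LEAD), the `p`-adic BSD conjecture of
  Mazur–Tate–Teitelbaum at every good ordinary `p ≥ 5` for the canonical height datum
  (`PAdicBSDConjecture W p D`, clause (ii)), and rationality of the period ratio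
  `ϖ · Ω_E = Ω⁺_f`, `ϖ ∈ ℚˣ` (Edixhoven 1991 §1; tree fact
  `ModularParametrizationData.realPeriodRat_dvd`) give the instance of `(ZZ^u_{r_an(E)})` for `E`
  with `Pᵢ` ANY Mordell–Weil basis and the single rational
  `c = #Ш · ∏ c_v / (#E(ℚ)_tors² · ϖ)` serving the archimedean identity and every `p` at once.
  Ingredients: a Mordell–Weil basis exists (`exists_isMordellWeilBasis_holds`), its Néron–Tate
  Gram determinant is `Reg(E/ℚ)` (`regulatorOf_eq_regulator_of_isMordellWeilBasis_holds`) and its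
  `p`-adic Gram determinant is `Reg_p(E, D)` (`padicRegulatorOf_eq_padicRegulator_holds`).
* `soloInformedUnif_of_bsdTriple_of_padicBSD`: hence BSD-triple (all `E`) ∧ `p`-adic BSD (all
  `E`, all good ordinary `p ≥ 5`, canonical `D`) ∧ period rationality ⇒ `(ZZ_r^u)` for every `r`.
* `soloInformedUnif_joint_of_unif`: `(ZZ_r^u) ⇒ (ZZ_r)` (reorder the quantifiers).

So `(ZZ_r^u)` sits BETWEEN the standard conjectures and the summit:
`BSD ∧ pBSD ⇒ (ZZ_r^u) ⇒ (ZZ_r)`, and `(ZZ_r^u)_{r≥2} ∧ Somewhere ⇒ BirchSwinnertonDyer`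
(`soloInformedUnif_birchSwinnertonDyer`). It is not a disguised strengthening of the summit: it
is exactly the leading-term content of BSD ∧ pBSD with `Ш`, Tamagawa numbers, torsion and the
period ratio packaged into one rational constant. Nothing here proves `(ZZ_r^u)` for any `r ≥ 2`.
-/

noncomputable section

open scoped Classical MatrixGroups ModularForm

open CongruenceSubgroup Literature.NumberTheory.EllipticCurves
  Literature.NumberTheory.EllipticCurves.ModularForms WeierstrassCurve WeierstrassCurve.Affine.Point
  Matrix

namespace Summit.BirchSwinnertonDyer.BirchSwinnertonDyer.Theorems

/-- **The `(ZZ^u_{r_an})` instance of a curve from its BSD triple and `p`-adic BSD.** Let `E/ℚ`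
(globally minimal `W`) satisfy RANK, `Ш` finite and LEAD (`W.BSDTriple`), the `p`-adic BSD
conjecture `PAdicBSDConjecture W p D` at every good ordinary `p ≥ 5` for the canonical datum `D`,
and let `f` be its newform with `ϖ · Ω_E = Ω⁺_f` for a non-zero rational `ϖ` (Edixhoven 1991, §1:
`m · Ω_E = |c_Manin| · Ω⁺_f`, tree fact `ModularParametrizationData.realPeriodRat_dvd`). Then for
any Mordell–Weil basis `P₁, …, P_r` (`r = rank = r_an`) and
`c = #Ш · ∏ c_v / (#E(ℚ)_tors² · ϖ) ∈ ℚ`: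
`L^{(r)}(E,1)/r! = c · Ω⁺_f · det⟨Pᵢ,Pⱼ⟩_NT` (LEAD, `det⟨Pᵢ,Pⱼ⟩_NT = Reg`) and, at every good
ordinary `p ≥ 5`, `[T^r]L_p · (log_p γ)^r = c · (1 - α⁻¹)² · det⟨Pᵢ,Pⱼ⟩_D` (pBSD (ii),
`det⟨Pᵢ,Pⱼ⟩_D = Reg_p(E,D)`). Mazur–Tate–Teitelbaum 1986, §II.10.
[cite: MazurTateTeitelbaum1986Invent, §II.10] -/
theorem soloInformedUnif_instance_of_bsdTriple_of_padicBSD (W : WeierstrassCurve ℚ)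
    [W.IsElliptic] [W.IsGloballyMinimal] (hT : W.BSDTriple)
    (hpBSD : ∀ (p : ℕ) [Fact p.Prime], 5 ≤ p → IsOrdinaryAt W p →
      ∀ (D : WeierstrassCurve.PAdicHeightData W p), D.IsCanonical → PAdicBSDConjecture W p D)
    {N : ℕ} [NeZero N] (f : CuspForm (Gamma0 N) 2) (hf : IsNewformOf W f)
    (hϖ : ∃ ϖ : ℚ, ϖ ≠ 0 ∧ (ϖ : ℝ) * W.realPeriodRat = plusPeriod f) :
    ∃ (P : Fin W.analyticRank → W.toAffine.Point) (c : ℚ),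
      W.leadingLCoeff = (((c : ℝ) * plusPeriod f * regulatorOf P : ℝ) : ℂ) ∧
      ∀ (p : ℕ) [Fact p.Prime], 5 ≤ p → IsOrdinaryAt W p →
        ∀ (D : WeierstrassCurve.PAdicHeightData W p), D.IsCanonical →
          PowerSeries.coeff W.analyticRank (padicLFunction f (unitRoot W p : ℚ_[p])) *
              padicLog p (cyclotomicGenerator p) ^ W.analyticRank =
            (c : ℚ_[p]) * (1 - (unitRoot W p : ℚ_[p])⁻¹) ^ 2 * padicRegulatorOf D P := by
  obtain ⟨hRank, hSha, hLead⟩ := hT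
  obtain ⟨ϖ, hϖ0, hϖ⟩ := hϖ
  have hB' : ∃ P : Fin W.mordellWeilRank → W.toAffine.Point, IsMordellWeilBasis P :=
    W.exists_isMordellWeilBasis_holds
  obtain ⟨B, hB⟩ := hB'
  have hRankEq : W.analyticRank = W.mordellWeilRank := hRank
  let e : Fin W.mordellWeilRank ≃ Fin W.analyticRank := finCongr hRankEq.symm
  have hP : IsMordellWeilBasis (B ∘ e.symm) := hB.reindex e
  have hRegP : regulatorOf (B ∘ e.symm) = W.regulator :=
    W.regulatorOf_eq_regulator_of_isMordellWeilBasis_holds hP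
  have hTors : 0 < W.torsionOrder := W.torsionOrder_pos_holds
  refine ⟨B ∘ e.symm, (W.shaOrder : ℚ) * W.tamagawaProduct / ((W.torsionOrder : ℚ) ^ 2 * ϖ),
    ?_, ?_⟩
  · -- archimedean side: LEAD, `det⟨Pᵢ,Pⱼ⟩ = Reg`, `Ω⁺_f = ϖ Ω_E`
    have hLead' : W.leadingLCoeff = (W.bsdRHS : ℂ) := hLead
    rw [hLead', bsdRHS_def, hRegP, ← hϖ]
    congr 1
    have hT0 : (W.torsionOrder : ℝ) ≠ 0 := by exact_mod_cast hTors.ne'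
    have hϖ0' : (ϖ : ℝ) ≠ 0 := by exact_mod_cast hϖ0
    have key : (((W.shaOrder : ℚ) * W.tamagawaProduct / ((W.torsionOrder : ℚ) ^ 2 * ϖ) : ℚ) : ℝ) *
        ((W.torsionOrder : ℝ) ^ 2 * (ϖ : ℝ)) = (W.shaOrder : ℝ) * (W.tamagawaProduct : ℝ) := by
      push_cast
      rw [div_mul_cancel₀ _ (mul_ne_zero (pow_ne_zero _ hT0) hϖ0')]
    rw [div_eq_iff (pow_ne_zero _ hT0)]
    linear_combination -(W.realPeriodRat * W.regulator) * key
  · -- `p`-adic side: pBSD (ii), `det⟨Pᵢ,Pⱼ⟩_D = Reg_p(E, D)`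
    intro p _ hp hord D hD
    have h2 := ((hpBSD p hp hord D hD) hord f hf).2 hSha ϖ hϖ
    rw [padicRegulatorOf_eq_padicRegulator_holds D hP, hRankEq]
    have hT0 : (W.torsionOrder : ℚ_[p]) ≠ 0 := by exact_mod_cast hTors.ne'
    have hϖ0' : (ϖ : ℚ_[p]) ≠ 0 := by exact_mod_cast hϖ0
    have key : (((W.shaOrder : ℚ) * W.tamagawaProduct / ((W.torsionOrder : ℚ) ^ 2 * ϖ) : ℚ) :
        ℚ_[p]) * ((W.torsionOrder : ℚ_[p]) ^ 2 * (ϖ : ℚ_[p])) =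
        (W.shaOrder : ℚ_[p]) * (W.tamagawaProduct : ℚ_[p]) := by
      push_cast
      rw [div_mul_cancel₀ _ (mul_ne_zero (pow_ne_zero _ hT0) hϖ0')]
    have h3 : (PowerSeries.coeff W.mordellWeilRank (padicLFunction f (unitRoot W p : ℚ_[p])) *
          padicLog p (cyclotomicGenerator p) ^ W.mordellWeilRank -
        (((W.shaOrder : ℚ) * W.tamagawaProduct / ((W.torsionOrder : ℚ) ^ 2 * ϖ) : ℚ) : ℚ_[p]) *
          (1 - (unitRoot W p : ℚ_[p])⁻¹) ^ 2 * padicRegulator D) *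
        ((W.torsionOrder : ℚ_[p]) ^ 2 * (ϖ : ℚ_[p])) = 0 := by
      linear_combination h2 - (1 - (unitRoot W p : ℚ_[p])⁻¹) ^ 2 * padicRegulator D * key
    exact sub_eq_zero.mp
      ((mul_eq_zero.mp h3).resolve_right (mul_ne_zero (pow_ne_zero _ hT0) hϖ0'))

/-- **BSD-triple ∧ `p`-adic BSD ∧ period rationality ⇒ `(ZZ_r^u)` for every `r`.** The uniform
joint receptacle is an intermediate of the standard conjectures as formalised (`BSDTriple`,
`PAdicBSDConjecture` at good ordinary `p ≥ 5` for the canonical datum), given the rationality of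
`Ω⁺_f / Ω_E` (a theorem for modular `E`, Edixhoven 1991 §1, kept as a hypothesis).
[cite: MazurTateTeitelbaum1986Invent, §II.10] -/
theorem soloInformedUnif_of_bsdTriple_of_padicBSD
    (hT : ∀ (W : WeierstrassCurve ℚ) [W.IsElliptic] [W.IsGloballyMinimal], W.BSDTriple)
    (hpBSD : ∀ (W : WeierstrassCurve ℚ) [W.IsElliptic] [W.IsGloballyMinimal] (p : ℕ)
      [Fact p.Prime], 5 ≤ p → IsOrdinaryAt W p →
      ∀ (D : WeierstrassCurve.PAdicHeightData W p), D.IsCanonical → PAdicBSDConjecture W p D)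
    (hϖ : ∀ (W : WeierstrassCurve ℚ) [W.IsElliptic] [W.IsGloballyMinimal] ⦃N : ℕ⦄ [NeZero N]
      (f : CuspForm (Gamma0 N) 2), IsNewformOf W f →
      ∃ ϖ : ℚ, ϖ ≠ 0 ∧ (ϖ : ℝ) * W.realPeriodRat = plusPeriod f)
    (r : ℕ) : JointHigherGrossZagierUnif r := by
  intro W _ _ hr N _ f hf
  subst hr
  exact soloInformedUnif_instance_of_bsdTriple_of_padicBSD W (hT W) (fun p _ => hpBSD W p) f hf
    (hϖ W f hf)

/-- `(ZZ_r^u) ⇒ (ZZ_r)`: the uniform receptacle implies the prime-wise one (reorder the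
quantifiers; the same `(P, c)` serves at the given prime). [cite: MazurTateTeitelbaum1986Invent, §II.10] -/
theorem soloInformedUnif_joint_of_unif {r : ℕ} (h : JointHigherGrossZagierUnif r) :
    JointHigherGrossZagier r := by
  intro W _ _ p _ hp hord hr D hD N _ f hf
  obtain ⟨P, c, hL, hall⟩ := h W hr f hf
  exact ⟨P, c, hL, hall p hp hord D hD⟩

end Summit.BirchSwinnertonDyer.BirchSwinnertonDyer.Theorems

end
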